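import Literature.Geometry.Lorentzian.Stationary
import Literature.Geometry.Lorentzian.KerrStationaryBlackHole
import Literature.Geometry.Lorentzian.KerrDataAsymptoticFlatness
import HarnessLib

/-!
# `StationaryAFBlackHole` is inhabited: the Schwarzschild / sub-extremal Kerr black hole, unconditionally

(Family `gr`; namespaces `Literature.Geometry.Lorentzian` and `Literature.Geometry.Lorentzian.Kerr`;
carrier-witness discharge for the hypothesis structure `StationaryAFBlackHole` of `Stationary.lean`.)

`Stationary.lean` formalises the hypotheses of the black-hole uniqueness theorem (Chruściel–Costa,
Astérisque 321 (2008), §1, §2.1) as the structure `StationaryAFBlackHole`: a `4`-dimensional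
spacetime, a connected spacelike slice with induced data `D` and an asymptotically flat end `e`,
and a complete Killing field `X₀` future-directed timelike on `M_ext = ⋃ₜ φₜ(embed(e.far (e.R + 1)))`.
`KerrStationaryBlackHole.lean` instantiates it on the Kerr family in the ingoing Kerr–Schild chart
(`Kerr.stationaryAFBlackHoleOn M a r₀ hM hAF`, `Kerr.stationaryAFBlackHole M a δ hMa hAF`;
Dafermos–Rodnianski arXiv:0811.0354, §5.1; O'Neill 1995, Ch. 2) under **three hypotheses**, every
one of which is by now a theorem of the tree:

* the instance hypothesis `[Kerr.Facts]` (`KerrSchild.lean`: connectedness of the chart domains,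
  analyticity of `x ↦ g_{M,a}(x)` and of `x ↦ V(x) = −g♯(dt*)`) — its three fields are the theorems
  `Kerr.isConnected_region_holds` (`KerrDataProofs.lean`), `Kerr.contMDiff_bilin_holds` and
  `Kerr.contMDiff_timeVector_holds` (`KerrSchildCoord.lean`);
* the instance hypothesis `[Kerr.SliceFacts]` (`KerrData.lean`) — the theorem `Kerr.sliceFacts_holds`
  (`KerrSliceFacts.lean`);
* the named fact `Kerr.isAsymptoticallyFlat_data` (`hAF`) — the theorem
  `Kerr.isAsymptoticallyFlat_data_holds` (`KerrDataAsymptoticFlatness.lean`).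

This file assembles them into an **unconditional** inhabitant:

* `Kerr.facts_holds : Kerr.Facts` — the instance hypothesis of `Kerr.metric` / `Kerr.spacetime` holds
  (theorem only, no global instance, as in `KerrSliceFacts.lean`);
* `Kerr.blackHole M a δ hMa : StationaryAFBlackHole` — the sub-extremal (`|a| < M`) Kerr black hole
  `Kerr.stationaryAFBlackHole M a δ hMa _` with all three hypotheses discharged; by `rfl` it *is*
  `Kerr.stationaryAFBlackHole …` (`Kerr.blackHole_eq`), so the whole API of
  `KerrStationaryBlackHole.lean` applies (`Kerr.blackHole_toSpacetime`, `Kerr.Mext_blackHole_subset_doc`);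
  its asymptotic region and hence its domain of outer communications are nonempty
  (`Kerr.Mext_blackHole_nonempty`, `Kerr.doc_blackHole_nonempty`);
* `StationaryAFBlackHole.schwarzschild = Kerr.blackHole 1 0 1` — the Schwarzschild black hole of
  mass `1` in ingoing Eddington–Finkelstein (= Kerr–Schild, `a = 0`) coordinates on the chart
  `{r > r₊ − 1} = {r > 1}`, which contains the event horizon `{r = 2}` (O'Neill 1995, Ch. 2, §2.5;
  Hawking–Ellis 1973, §5.5; Wald 1984, §6.4);
* `StationaryAFBlackHole_nonempty : Nonempty StationaryAFBlackHole.{0}` and the corresponding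
  global `Nonempty` instance.

## Universe

`StationaryAFBlackHole.{u}` extends `Spacetime.{u} 4` and carries a slice `X : Type u`. The Kerr
chart domains are subtypes of `E4 = EuclideanSpace ℝ (Fin 4) : Type`, so the witness lives in
universe `0` — the universe over which the route items quantify (`∀ 𝓑 : StationaryAFBlackHole.{0}, …`).
No statement is made about `StationaryAFBlackHole.{u}` for `u > 0` (it is inhabited as well, by
lifting the carrier along `ULift`, but Mathlib has no manifold structure on `ULift` at the pin and
nothing in the tree needs it).

## What is NOT here

The identifications `doc = {r > r₊}`, `𝓔⁺ = {r = r₊}` for the witness, non-degeneracy /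
connectedness of its horizon and its analyticity `StationaryAFBlackHole.IsAnalytic` (the further
hypotheses of gr.S23, stated separately from the structure) are not needed for inhabitation and are
not proved here (cf. the module docstring of `KerrStationaryBlackHole.lean`). No new definition of a
notion and no named fact is introduced.

## References

* M. Dafermos, I. Rodnianski, *Lectures on black holes and linear waves*, arXiv:0811.0354, §5.1
  (ingoing Kerr coordinates, the slices `{t* = c}`, `∂_{t*}` Killing).
* B. O'Neill, *The geometry of Kerr black holes*, A K Peters 1995, Ch. 2, §§2.2–2.5.
* P. T. Chruściel, J. L. Costa, *On uniqueness of stationary vacuum black holes*, Astérisque 321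
  (2008), §2.1–2.2 ((2.1) `M_ext`, (2.2) `⟨⟨M_ext⟩⟩`), Thm. 1.3 (Kerr is the model of the
  uniqueness theorem, in particular satisfies its hypotheses).
* S. W. Hawking, G. F. R. Ellis, *The large scale structure of space-time*, CUP 1973, §5.5
  (Schwarzschild in ingoing Eddington–Finkelstein coordinates), §9.3.
* R. M. Wald, *General Relativity*, Chicago 1984, §6.4, §12.3.
-/

noncomputable section

open Set

namespace Literature.Geometry.Lorentzian

namespace Kerr

/-! ### The instance hypothesis `Kerr.Facts` holds -/

/-- **`Kerr.Facts` holds**: the three named facts bundled in the instance hypothesis `[Kerr.Facts]`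
of `Kerr.metric` / `Kerr.timeOrientation` / `Kerr.spacetime` are theorems — the chart domains
`Kerr.region a r₀` are connected (`Kerr.isConnected_region_holds`; O'Neill 1995, Ch. 2, §2.1) and the
sections `x ↦ g_{M,a}(x)`, `x ↦ V(x) = −g♯(dt*)` are real-analytic (`Kerr.contMDiff_bilin_holds`,
`Kerr.contMDiff_timeVector_holds`; Kerr–Schild 1965, Dafermos–Rodnianski arXiv:0811.0354, §5.1). A
theorem, not a global instance (house pattern of `Kerr.sliceFacts_holds`): write
`haveI := Kerr.facts_holds`. [cite: arXiv08110354, §5.1] -/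
theorem facts_holds : Facts :=
  ⟨isConnected_region_holds, contMDiff_bilin_holds, contMDiff_timeVector_holds⟩

/-! ### The sub-extremal Kerr black hole, unconditionally -/

/-- **The sub-extremal Kerr black hole as a stationary asymptotically flat black-hole spacetime,
with no hypothesis left**: `Kerr.stationaryAFBlackHole M a δ hMa hAF` (`|a| < M`; the
horizon-penetrating ingoing Kerr–Schild chart `{r > r₊ − δ}` with the slice `{t* = 0}`, its induced
data, the far end `{‖y‖ > R_T}` and the Killing field `∂_{t*}`), its instance hypotheses
`[Kerr.Facts]`, `[Kerr.SliceFacts]` supplied by `Kerr.facts_holds`, `Kerr.sliceFacts_holds` and the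
named fact `hAF` by `Kerr.isAsymptoticallyFlat_data_holds`. Intended range `0 < δ < r₊ − r₋` (the
chart then contains the future event horizon `{r = r₊}`); valid for every real `δ`.
Dafermos–Rodnianski arXiv:0811.0354, §5.1; O'Neill 1995, Ch. 2, §§2.4–2.5; Chruściel–Costa,
Astérisque 321 (2008), §2.1 and Thm. 1.3. [cite: arXiv08110354, §5.1] -/
def blackHole (M a δ : ℝ) (hMa : IsSubextremal M a) : StationaryAFBlackHole.{0} :=
  haveI : Facts := facts_holds
  haveI : SliceFacts := sliceFacts_holds
  stationaryAFBlackHole M a δ hMa (isAsymptoticallyFlat_data_holds M a (rPlus M a - δ))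

variable (M a δ : ℝ) (hMa : IsSubextremal M a)

/-- `Kerr.blackHole` *is* `Kerr.stationaryAFBlackHole` (by `rfl`: the instance hypotheses are
propositions), so every result of `KerrStationaryBlackHole.lean` applies to it. [cite: arXiv08110354, §5.1] -/
theorem blackHole_eq [Facts] [SliceFacts] :
    blackHole M a δ hMa =
      stationaryAFBlackHole M a δ hMa (isAsymptoticallyFlat_data_holds M a (rPlus M a - δ)) :=
  rfl

/-- `Kerr.blackHole` is `Kerr.stationaryAFBlackHoleOn` at the inner radius `r₀ = r₊ − δ` (by `rfl`).
[cite: arXiv08110354, §5.1] -/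
theorem blackHole_eq_stationaryAFBlackHoleOn [Facts] [SliceFacts] :
    blackHole M a δ hMa = stationaryAFBlackHoleOn M a (rPlus M a - δ) hMa.pos.le
      (isAsymptoticallyFlat_data_holds M a (rPlus M a - δ)) :=
  rfl

/-- The spacetime of `Kerr.blackHole M a δ` is the Kerr chart `Kerr.spacetime M a (r₊ − δ)`
(by `rfl`). [cite: arXiv08110354, §5.1] -/
@[simp]
theorem blackHole_toSpacetime [Facts] :
    (blackHole M a δ hMa).toSpacetime = spacetime M a (rPlus M a - δ) hMa.pos.le :=
  rfl

/-- The carrier of `Kerr.blackHole M a δ` is the chart domain `Kerr.region a (r₊ − δ)` (by `rfl`).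
[cite: arXiv08110354, §5.1] -/
theorem blackHole_carrier : (blackHole M a δ hMa).carrier = region a (rPlus M a - δ) :=
  rfl

/-- The Killing field of `Kerr.blackHole` is `∂_{t*}` (by `rfl`). [cite: ONeill1995, Ch. 2 §2.2] -/
@[simp]
theorem blackHole_killing :
    (blackHole M a δ hMa).killing = stationaryField a (rPlus M a - δ) :=
  rfl

/-- **`M_ext ⊆ ⟨⟨M_ext⟩⟩`** for the unconditional Kerr black hole (`Kerr.Mext_subset_doc`).
Chruściel–Costa, Astérisque 321 (2008), §2.2. [cite: ChruscielCosta2008, §2.2] -/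
theorem Mext_blackHole_subset_doc : (blackHole M a δ hMa).Mext ⊆ (blackHole M a δ hMa).doc :=
  haveI : Facts := facts_holds
  haveI : SliceFacts := sliceFacts_holds
  Mext_subset_doc hMa.pos.le a (rPlus M a - δ) (isAsymptoticallyFlat_data_holds M a (rPlus M a - δ))

/-- **The asymptotic region `M_ext` of the Kerr black hole is nonempty**: the slice point
`y = (R_T + 2) e₀` lies beyond the coordinate sphere `‖y‖ = R_T + 1`, so `(0, y) ∈ M_ext`
(`Kerr.mem_Mext_stationaryAFBlackHoleOn_iff`). Chruściel–Costa, Astérisque 321 (2008), (2.1).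
[cite: ChruscielCosta2008, (2.1)] -/
theorem Mext_blackHole_nonempty : (blackHole M a δ hMa).Mext.Nonempty := by
  haveI : Facts := facts_holds
  haveI : SliceFacts := sliceFacts_holds
  set r₀ : ℝ := rPlus M a - δ with hr₀
  have hR : 0 < stationaryRadius M a r₀ := stationaryRadius_pos hMa.pos.le a r₀
  set c : ℝ := stationaryRadius M a r₀ + 2 with hc
  have hc0 : 0 < c := by linarith
  let y : E3 := EuclideanSpace.single 0 c
  have hy : ‖y‖ = c := by
    simp [y, abs_of_pos hc0]
  have hys : y ∈ slice a r₀ :=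
    mem_slice_of_stationaryRadius_lt hMa.pos.le (by rw [hy]; linarith)
  refine ⟨sliceEmbed a r₀ ⟨y, hys⟩, ?_⟩
  refine (mem_Mext_stationaryAFBlackHoleOn_iff hMa.pos.le a r₀
    (isAsymptoticallyFlat_data_holds M a r₀)).2 ?_
  rw [coe_sliceEmbed, E4.spatial_ofTimeSpace]
  change stationaryRadius M a r₀ + 1 < ‖y‖
  rw [hy]
  linarith

/-- **The domain of outer communications of the Kerr black hole is nonempty** (`M_ext ≠ ∅` and
`M_ext ⊆ ⟨⟨M_ext⟩⟩`). Chruściel–Costa, Astérisque 321 (2008), §2.2. [cite: ChruscielCosta2008, §2.2] -/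
theorem doc_blackHole_nonempty : (blackHole M a δ hMa).doc.Nonempty :=
  (Mext_blackHole_nonempty M a δ hMa).mono (Mext_blackHole_subset_doc M a δ hMa)

end Kerr

/-! ### The witness and `Nonempty` -/

namespace StationaryAFBlackHole

/-- **The Schwarzschild black hole of mass `1` as a `StationaryAFBlackHole`**: `Kerr.blackHole 1 0 1`,
i.e. the Kerr–Schild chart with `M = 1`, `a = 0` (Schwarzschild in ingoing Eddington–Finkelstein
coordinates, `g = η + (2M/r) ℓ ⊗ ℓ`) on `{r > r₊ − 1} = {r > 1}`, which contains the event horizon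
`{r = 2M = 2}`, with the slice `{t* = 0}`, its induced (asymptotically flat of order `1`) data, the
far end and the static Killing field `∂_{t*}`. Hawking–Ellis 1973, §5.5; Wald 1984, §6.4;
O'Neill 1995, Ch. 2, §2.5; it satisfies the hypotheses of the uniqueness theorem,
Chruściel–Costa, Astérisque 321 (2008), Thm. 1.3. [cite: HawkingEllis1973, §5.5] -/
def schwarzschild : StationaryAFBlackHole.{0} :=
  Kerr.blackHole 1 0 1 (show |(0 : ℝ)| < 1 by rw [abs_zero]; exact one_pos)

/-- The witness is the Kerr black hole with `M = 1`, `a = 0`, `δ = 1` (by `rfl`). [folklore] -/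
theorem schwarzschild_eq :
    schwarzschild = Kerr.blackHole 1 0 1 (show |(0 : ℝ)| < 1 by rw [abs_zero]; exact one_pos) :=
  rfl

/-- The inner chart radius of the witness is `r₊ − 1 = 1 < 2 = r₊`: the chart `{r > 1}` of
`StationaryAFBlackHole.schwarzschild` contains the Schwarzschild horizon `{r = 2}`.
O'Neill 1995, Ch. 2, §2.5. [cite: ONeill1995, Ch. 2 §2.5] -/
theorem rPlus_one_zero_sub_one : Kerr.rPlus 1 0 - 1 = 1 ∧ Kerr.rPlus 1 0 - 1 < Kerr.rPlus 1 0 := by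
  rw [Kerr.rPlus_zero_right zero_le_one]
  norm_num

/-- The domain of outer communications of the witness is nonempty (so statements about
`𝓑.doc` are not vacuous on it). Chruściel–Costa, Astérisque 321 (2008), §2.2. [cite: ChruscielCosta2008, §2.2] -/
theorem doc_schwarzschild_nonempty : schwarzschild.doc.Nonempty :=
  Kerr.doc_blackHole_nonempty 1 0 1 _

end StationaryAFBlackHole

/-- **The hypothesis structure `StationaryAFBlackHole` is inhabited** (in universe `0`, the universe
of the route items quantifying over it): the Schwarzschild black hole
`StationaryAFBlackHole.schwarzschild` — equivalently any sub-extremal Kerr black hole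
`Kerr.blackHole M a δ hMa` — is a stationary asymptotically flat black-hole spacetime in the sense of
`Stationary.lean`, with every field proved and no hypothesis left. Chruściel–Costa, Astérisque 321
(2008), §2.1 and Thm. 1.3 (Kerr satisfies the hypotheses of the uniqueness theorem);
Dafermos–Rodnianski arXiv:0811.0354, §5.1. [cite: ChruscielCosta2008, §2.1] -/
theorem StationaryAFBlackHole_nonempty : Nonempty StationaryAFBlackHole.{0} :=
  ⟨StationaryAFBlackHole.schwarzschild⟩

/-- `StationaryAFBlackHole.{0}` is nonempty, as a global instance (from
`StationaryAFBlackHole_nonempty`). [cite: ChruscielCosta2008, §2.1] -/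
instance StationaryAFBlackHole.instNonempty : Nonempty StationaryAFBlackHole.{0} :=
  StationaryAFBlackHole_nonempty

end Literature.Geometry.Lorentzian

end
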